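import Summits.BirchSwinnertonDyer.Rank1Residual.ManinAdditive.NeronOmegaThree
import HarnessLib
import HarnessLib.Audit.Tags

/-!
# «TRACE = Ω» (E-imc-156a–d), LAWS L3f/L3g (E-imc-153c, 153e/f) and the TANGENT-DEFECT lever (E-imc-157R/158) at `3` — typed
# (imc g20, MEMO-imc §26 (26.10‴)/(26.10⁗)/(26.14); cell `bsd-f2-manin`, T-imc-26 part 2/2, typer g15)

HONEST FRAMING.  Continuation of `NeronOmegaThree.lean` (same source: HOME/imc/Sketch-imc-g20.lean, FROZEN sha16 f94678ca0337d6c7, 615 l.,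
§0–§5 byte-identical to a4ae1703200af20d; farm rc 0 · 0 sorries per imc; BC7 12/12 CLEAN, HOME/imc/g20-bc7c-g.raw.txt 4e6104bdce2a1b2b),
§5–§7 VERBATIM in namespace `…ManinAdditive.NeronOmegaThree`, except: (i) this header; (ii) two undocumented helper theorems received one-line
docstrings; (iii) DEDUP — the sketch's `HasRationalThreeTorsion` is the tree's `RamanujanCut.HasRationalThreeTorsion` (identical body; part 1
precedent); (iv) **E-imc-153d `OmegaFullDepthOffClassV2AtThree` is NOT LANDED** — REFUTED out of sample by the owner (999a1, 1161d1; MEMO-imc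
(26.10⁗)(a)); a `/- … -/` note marks its place; the two consumers of the killed E-imc-153b (part 1) are RE-POINTED to the class-V3 laws of L3g
(`omegaDefectAtThreeLeOne_of_lawsV3`, `not_three_dvd_maninConstant_of_fullDepthOffClassV3`; same two-line proofs); (v) **E-imc-157 is landed
ONLY in its REPAIRED form** `TangentDefectOnClassV3AtThreeR` — REF1 §R90: the sketch's E-157 (no Ω/Néron binder on `Δ`; re-targeted by imc from
class V2 to V3 at 22:13Z, binder still absent) is KILLED-as-typed (the junk datum `Λ_max = {g ∈ S^AL : (deg/c)·q(g) ∈ ℤ}` is Lie-saturated at 3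
on every class row, ref1 e90 292/292, `c`-free — a class-independent argument); REPAIR = insert `IsOmegaNeronAtThree Δ →`; on the class the
repaired law ⟺ `3 ∤ c_E` (a reformulation, ref1) — the assembly passes `hΛ`.

CONTENTS: §5 **E-imc-156a–d** «TRACE = Ω» (`IsThreeAdicMem`, `drLatticeAtThree`, `traceCutAtThree`, `redTraceCutAtThree` over the tree's
`adjDegeneracyMap0 N M 1 2`; BC5 kit j317779 50/50, j318056 40/40 levels `9 ∣ N ≤ 450`); §6 LAW L3f — `HasCongruentIVStarPartnerAtThree`,
`IsOmegaDefectClassAtThreeV2`, **E-imc-153c** (82/82 class-V2 rows `≤ 1026`; SURVIVES REF1 §R90) — and LAW L3g — `HasEisensteinIVStarCompanionAtThree`,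
`IsOmegaDefectClassAtThreeV3`, **E-imc-153e** (117/117 class-V3 rows `≤ 1251`) / **E-imc-153f** (508/508 rows off class V3), pre-registered
BEFORE the OOS chunks (MEMO-imc (26.10⁗)(b)(c); REF1 audit of 153e/f PENDING at filing) + the two re-pointed PROVED edges; §7
`HasShallowByOneWitnessAt`, PROVED glue `not_dvd_maninConstant_of_shallowByOne_of_not_lieSaturated`, **E-imc-157R**, support **E-imc-158**,
ASSEMBLY `not_three_dvd_maninConstant_of_tangentDefect` (PROVED modulo the named hypotheses E-imc-150/151/152/153f/157R/158).
REFUTER VERDICTS: REF1 §R90 (E-157 KILLED-as-typed → repaired here; E-153b KILLED → not landed, part 1; E-150…156, 153c SURVIVE); E-153d refuted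
by owner; E-153e/f/158 REF1 PENDING.  bears_on: stmt-BirchSwinnertonDyer-22968.  PARTITION (imc) frontier-data → ladder-adjacent ·
beyond-print theorem: no · `3 ∤ c_E` is NOT proved by this; BSD is not proved by this; Manin's conjecture is not proved by this.
-/

noncomputable section

open scoped MatrixGroups ModularForm
open CongruenceSubgroup Literature.NumberTheory.EllipticCurves.ModularForms
  Summit.BirchSwinnertonDyer.Rank1Residual.ManinAdditive
  Summit.BirchSwinnertonDyer.Rank1Residual.ManinAdditive.ConwayCut
  Summit.BirchSwinnertonDyer.Rank1Residual.ManinAdditive.ConwayNortonThree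
  Summit.BirchSwinnertonDyer.Rank1Residual.ManinAdditive.NeronCuspThree

namespace Summit.BirchSwinnertonDyer.Rank1Residual.ManinAdditive.NeronOmegaThree

variable (N : ℕ) [NeZero N]

/-! ### §5. Conjecture E-imc-156 «TRACE = Ω» (MEMO-imc (26.14)(iii)) — typed over the tree's adjoint degeneracy map

ENGINE 8's print-only lattice, spelled with in-tree operators: `Tr := adjDegeneracyMap0 N M 1 2` (the trace
`S₂(Γ₀(N)) → S₂(Γ₀(M))`, `N = 3M`, Hecke correspondence `[Γ₀(N) · 1 · Γ₀(M)]`), the Fricke involution `w_N`, the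
Atkin–Lehner involution `w_{3^{v}}` at 3, and a LOWER lattice `Λlow ⊆ S₂(Γ₀(M))` standing for (a print upper bound of)
`Cot(𝒥₀(M)) ⊗ ℤ₍₃₎`: at `3 ∥ M` the Deligne–Rapoport lattice `drLatticeAtThree M` [Edixhoven 2006, Props. 4–5: GIVEN
fact (γ), audit R-imc-60], at `9 ∥ M` recursively `Ω₃(M)` (by the `v = 2` case).  All memberships are 3-ADIC (up to
prime-to-3 multiples), so the lattices below have 3-power index in `S` and «equal 3-adically» ⟺ «equal».
COMPUTED (kit j317779): `traceCutAtThree (3M) M (drLatticeAtThree M) = Ω₃(3M)` for every `3 ∥ M`, `9M ≤ 960`, and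
`traceCutAtThree (3M) M (Ω₃ M) = Ω₃(3M)` for every `9 ∥ M`, `3M ≤ 960` — 50/50 levels at the time of typing.
Nothing in this section is asserted; E-156a/b are conjectures (BC5 = the ENGINE 8 table), print-provable candidates
(pure cusp combinatorics: above a cusp of `X₀(M)` lie three cusps of `X₀(N)`, two of them conjugate over `ℚ₃(ζ₃)`, and
`{e : Tr_{ℚ₃(ζ₃)/ℚ₃}(e ℤ₃[ζ₃]) ⊆ ℤ₃} = (1 − ζ₃)⁻¹ = 𝔇⁻¹` is exactly the allowance of `IsPiIntegralUpToDifferent`). -/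

section Trace

/-- 3-adic membership in a `ℤ`-lattice of cusp forms: some prime-to-3 multiple lies in it. -/
def IsThreeAdicMem {M : ℕ} (Λ : Submodule ℤ (CuspForm (Gamma0 M) 2)) (y : CuspForm (Gamma0 M) 2) : Prop :=
  ∃ m : ℕ, ¬ 3 ∣ m ∧ (m : ℂ) • y ∈ Λ

/-- The **Deligne–Rapoport lattice at 3** of level `M` (`3 ∥ M` intended): integral forms `y` with `w₃ y` 3-adically
integral — by [Edixhoven 2006, Prop. 5] and `w₃(C_∞) = C_0` this is `Cot(𝒥₀(M)) ⊗ ℤ₍₃₎ = H⁰(X₀(M)_{ℤ₃}, Ω)` inside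
`S₂(Γ₀(M); ℤ₃)` (GIVEN print fact (γ); nothing asserted).  Junk (but harmless: still an UPPER bound of nothing we use) if `9 ∣ M`. -/
def drLatticeAtThree (M : ℕ) [NeZero M] : Submodule ℤ (CuspForm (Gamma0 M) 2) :=
  sSup {L | L ≤ integralCuspForms0 M 2 ∧ ∀ y ∈ L, IsThreeIntegral M (atkinLehnerInvolutionAt M 2 3 y)}

/-- **ENGINE 8's trace cut** `L_tr(N; M, Λlow)`: the largest sub-`ℤ`-module of `S₂(Γ₀(N); ℤ)` whose elements `x` have
(C_0) `w_{3^v} x` 3-adically integral (reduced component through the cusp 0), (Tr) `Tr x ∈ Λlow` and (Tr∘w_N)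
`Tr (w_N x) ∈ Λlow` 3-adically, `Tr = adjDegeneracyMap0 N M 1 2`.  PRINT (α)+(β) [Edixhoven 2006 Prop. 2; Néron
functoriality of Pic-functoriality `J₀(M) → J₀(N)` whose cotangent map is `Tr`; `w_N` extends to the Néron model]:
`Λ_N ⊗ ℤ₍₃₎ ⊆ L_tr(N; M, Λlow)` whenever `N = 3M` and `Cot(𝒥₀(M)) ⊗ ℤ₍₃₎ ⊆ Λlow ⊗ ℤ₍₃₎` (GIVEN row E-imc-155's source). -/
def traceCutAtThree (N M : ℕ) [NeZero N] [NeZero M] (Λlow : Submodule ℤ (CuspForm (Gamma0 M) 2)) :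
    Submodule ℤ (CuspForm (Gamma0 N) 2) :=
  sSup {L | L ≤ integralCuspForms0 N 2 ∧ ∀ x ∈ L,
    IsThreeIntegral N (atkinLehnerInvolutionAt N 2 3 x) ∧
    IsThreeAdicMem Λlow (adjDegeneracyMap0 N M 1 2 x) ∧
    IsThreeAdicMem Λlow (adjDegeneracyMap0 N M 1 2 (frickeInvolution N 2 x))}

/-- The trace cut is a sublattice of `S₂(Γ₀(N); ℤ)`. -/
theorem traceCutAtThree_le (N M : ℕ) [NeZero N] [NeZero M] (Λlow : Submodule ℤ (CuspForm (Gamma0 M) 2)) :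
    traceCutAtThree N M Λlow ≤ integralCuspForms0 N 2 :=
  sSup_le fun _ hL => hL.1

/-- **E-imc-156a `TraceCutEqOmegaAtNine`** (conjecture; computed 3-adically at every `9 ∥ N ≤ 960` by ENGINE 8):
for `3 ∥ M`, the trace cut of level `3M` over the Deligne–Rapoport lattice of level `M` IS the dualising-sheaf lattice
`Ω₃(3M)`.  Why it might fail: only at uncomputed levels, via purely `3M`-new congruences invisible to both traces
(none seen ≤ 960); a proof should be cusp-by-cusp (inverse different = trace dual). -/
@[conjecture] def TraceCutEqOmegaAtNine : Prop :=
  ∀ (M : ℕ) [NeZero M], 3 ∣ M → ¬ 9 ∣ M →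
    traceCutAtThree (3 * M) M (drLatticeAtThree M) = omegaLatticeAtThree (3 * M)

/-- **E-imc-156b `TraceCutEqOmegaAtTwentySeven`** (conjecture; computed at every `27 ∥ N ≤ 960`): for `9 ∥ M`, the
trace cut of level `3M` over `Ω₃(M)` IS `Ω₃(3M)`. -/
@[conjecture] def TraceCutEqOmegaAtTwentySeven : Prop :=
  ∀ (M : ℕ) [NeZero M], 9 ∣ M → ¬ 27 ∣ M →
    traceCutAtThree (3 * M) M (omegaLatticeAtThree M) = omegaLatticeAtThree (3 * M)

/-- The INCLUSION halves that carry the E-facing content (with (α)(β)(γ): `Λ ⊆ L_tr ⊆ Ω₃`), stated separately so a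
refuter can attack the cheap direction first. -/
@[conjecture] def TraceCutLeOmegaAtNine : Prop :=
  ∀ (M : ℕ) [NeZero M], 3 ∣ M → ¬ 9 ∣ M →
    traceCutAtThree (3 * M) M (drLatticeAtThree M) ≤ omegaLatticeAtThree (3 * M)

/-- E-imc-156a ⟹ its inclusion half (PROVED). -/
theorem traceCutLeOmegaAtNine_of_eq (h : TraceCutEqOmegaAtNine) : TraceCutLeOmegaAtNine :=
  fun M _ h3 h9 => (h M h3 h9).le

/-- **Minimal form (kit j318056, VAR lines, 40/40 levels `9 ∣ N ≤ 450`)**: ONE trace condition suffices —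
`Ω₃(N) = {x ∈ S : w_{3^v} x 3-integral ∧ Tr x ∈ Λlow 3-adically}`; dropping the `w`-condition fails at 33/40 levels,
dropping the trace condition is `L_red ⊋ Ω₃` at 32/40.  The reduced components are read by `w`, ALL non-reduced ones by
the single degeneracy trace to level `N/3`. -/
def redTraceCutAtThree (N M : ℕ) [NeZero N] [NeZero M] (Λlow : Submodule ℤ (CuspForm (Gamma0 M) 2)) :
    Submodule ℤ (CuspForm (Gamma0 N) 2) :=
  sSup {L | L ≤ integralCuspForms0 N 2 ∧ ∀ x ∈ L,
    IsThreeIntegral N (atkinLehnerInvolutionAt N 2 3 x) ∧ IsThreeAdicMem Λlow (adjDegeneracyMap0 N M 1 2 x)}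

/-- **E-imc-156c `OmegaEqRedTraceAtNine`** (conjecture, the minimal recursive characterisation at `9 ∥ N`; BC5: kit j318056
31/31 levels `v₃ = 2`, `N ≤ 450`): `Ω₃(3M) = {x : w₉ x 3-integral, Tr x ∈ DR(M)}` for `3 ∥ M`. -/
@[conjecture] def OmegaEqRedTraceAtNine : Prop :=
  ∀ (M : ℕ) [NeZero M], 3 ∣ M → ¬ 9 ∣ M →
    redTraceCutAtThree (3 * M) M (drLatticeAtThree M) = omegaLatticeAtThree (3 * M)

/-- **E-imc-156d `OmegaEqRedTraceAtTwentySeven`** (conjecture; BC5: kit j318056 9/9 levels `v₃ = 3`, `N ≤ 450`):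
`Ω₃(3M) = {x : w₂₇ x 3-integral, Tr x ∈ Ω₃(M)}` for `9 ∥ M` — the dualising-sheaf lattice propagates up the 3-tower by
one trace per storey. -/
@[conjecture] def OmegaEqRedTraceAtTwentySeven : Prop :=
  ∀ (M : ℕ) [NeZero M], 9 ∣ M → ¬ 27 ∣ M →
    redTraceCutAtThree (3 * M) M (omegaLatticeAtThree M) = omegaLatticeAtThree (3 * M)

end Trace

/-! ### §6. LAW L3f (MEMO-imc (26.10‴)): the IV* split is a MOD-3 CONGRUENCE invariant — repaired Kodaira laws E-imc-153c/d

ENGINE 7's census (`9 ∣ N ≤ 1026`, 470 optimal classes) fits, with NO exception: `σ₃^Ω(E) = 1` iff `E` has Kodaira type II* or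
III* at 3, or type IV* AND there is ANOTHER optimal elliptic curve `E'` of the same conductor, also of type IV* at 3, with
`a_ℓ(E) ≡ a_ℓ(E') (mod 3)` for all primes `ℓ ∤ 3N` (tested `ℓ ≤ 61`) — 22/22 IV* rows with such a partner have the defect,
5/5 without (27a1, 54a1, 270a1, 459f1, 594c1) have full depth; II*/III* rows have the defect with or without partners
(III*: 35/37 have none); I_n*/II/III/IV rows never have it (83 of them DO have congruent starred partners).  Pre-registered
for the levels `1035…1300` (NOTES g20-7).  Typed below with the tree's `cuspCoeff` (q-expansion coefficients of the newforms). -/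

section CongruentPartner

variable {N}

/-- `E` (through its optimal newform `D.f`) has a CONGRUENT IV*-PARTNER at level `N`: another optimal parametrisation
`D'` at the same level, of a globally minimal curve of Kodaira type IV* at 3, with a different newform whose prime-index
Fourier coefficients away from `3N` are congruent to those of `D.f` modulo 3. -/
def HasCongruentIVStarPartnerAtThree {W : WeierstrassCurve ℚ} [W.IsElliptic]
    (D : ModularParametrizationData W N) : Prop :=
  ∃ (W' : WeierstrassCurve ℚ) (_ : W'.IsElliptic) (_ : W'.IsGloballyMinimal) (D' : ModularParametrizationData W' N),
    (∀ (W'' : WeierstrassCurve ℚ) [W''.IsElliptic] (D'' : ModularParametrizationData W'' N),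
        D''.f = D'.f → D'.modularDegree ≤ D''.modularDegree) ∧
    D'.f ≠ D.f ∧ W'.kodairaSymbolAt placeThree = .IVstar ∧
    ∀ ℓ : ℕ, ℓ.Prime → ¬ ℓ ∣ 3 * N → ∃ z : ℤ, ((3 * z : ℤ) : ℂ) = cuspCoeff D.f ℓ - cuspCoeff D'.f ℓ

/-- The REPAIRED Ω-defect class at 3 (law L3f): II* or III*, or IV* with a congruent IV*-partner. -/
def IsOmegaDefectClassAtThreeV2 {W : WeierstrassCurve ℚ} [W.IsElliptic] (D : ModularParametrizationData W N) : Prop :=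
  W.kodairaSymbolAt placeThree = .IIstar ∨ W.kodairaSymbolAt placeThree = .IIIstar ∨
    (W.kodairaSymbolAt placeThree = .IVstar ∧ HasCongruentIVStarPartnerAtThree D)

/-- **E-imc-153c `OmegaDefectOfClassV2AtThree`** (LAW L3f, defect direction; nothing asserted; BC5: ENGINE 7 census, 82/82
class-V2 rows `≤ 1026`): an optimal curve in the repaired class loses EXACTLY one factor 3 of Ω-depth.  With E-imc-155 (print +
computation per level) and Cremona's `c_E = 1`: `E → J₀(N)` is not Lie-saturated at 3 for every such curve.
Why it might fail: a IV* curve whose only mod-3 congruent IV*-companions are NON-rational newforms (invisible to this clause)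
— would show as a defect row outside the class (none `≤ 1026`). -/
@[conjecture] def OmegaDefectOfClassV2AtThree : Prop :=
  ∀ (W : WeierstrassCurve ℚ) [W.IsElliptic] [W.IsGloballyMinimal] [NeZero (W.conductorNorm ℤ)]
    (D : ModularParametrizationData W (W.conductorNorm ℤ)),
    (∀ z ∈ D.L.lattice, ∃ w ∈ periodLattice D.f, z = D.c * w) →
    (∀ (W' : WeierstrassCurve ℚ) [W'.IsElliptic]
        (D' : ModularParametrizationData W' (W.conductorNorm ℤ)),
        D'.f = D.f → D.modularDegree ≤ D'.modularDegree) →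
    9 ∣ W.conductorNorm ℤ → ¬ 81 ∣ W.conductorNorm ℤ → IsOmegaDefectClassAtThreeV2 D →
      padicValNat 3 (lineIndex (omegaLatticeAtThree (W.conductorNorm ℤ)) D.f) + 1 = padicValNat 3 D.modularDegree

/- E-imc-153d `OmegaFullDepthOffClassV2AtThree` (LAW L3f, full-depth direction OFF class V2; sketch lines here) is NOT landed:
REFUTED out of sample by the owner's ENGINE 7 (999a1, N = 27·37, and 1161d1, N = 27·43: IV*, `E(ℚ)[3] = 0`, NO mod-3-congruent optimal
IV*-partner, yet `σ^Ω = 1`; MEMO-imc (26.10⁗)(a)) — the rational-partner clause is too narrow for torsion-free IV*.  Repaired: class V3 and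
laws E-imc-153e/f below (LAW L3g, 625/625 optimal classes `9 ∣ N ≤ 1251`, `81 ∤ N`).  Kept here as negative knowledge only. -/

/-- `E` has an EISENSTEIN IV*-COMPANION at level `N`: another optimal parametrisation at the same level, different newform, of a
globally minimal curve of Kodaira type IV* at 3 WITH rational 3-torsion (two such newforms are automatically congruent mod 3:
`a_ℓ ≡ 1 + ℓ`). -/
def HasEisensteinIVStarCompanionAtThree {W : WeierstrassCurve ℚ} [W.IsElliptic]
    (D : ModularParametrizationData W N) : Prop :=
  ∃ (W' : WeierstrassCurve ℚ) (_ : W'.IsElliptic) (_ : W'.IsGloballyMinimal) (D' : ModularParametrizationData W' N),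
    (∀ (W'' : WeierstrassCurve ℚ) [W''.IsElliptic] (D'' : ModularParametrizationData W'' N),
        D''.f = D'.f → D'.modularDegree ≤ D''.modularDegree) ∧
    D'.f ≠ D.f ∧ W'.kodairaSymbolAt placeThree = .IVstar ∧ RamanujanCut.HasRationalThreeTorsion W'

/-- The Ω-defect class at 3, THIRD form (law L3g, 625/625 optimal classes `9 ∣ N ≤ 1251`, `81 ∤ N`): II*, III*, IV* without
rational 3-torsion, or IV* with rational 3-torsion and an Eisenstein IV*-companion.  Equivalently: an exceptional-star curve is
OFF the class iff it is IV*, Eisenstein mod 3, and the unique such optimal class at its level (27a1, 54a1, 270a1, 459f1, 594c1). -/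
def IsOmegaDefectClassAtThreeV3 {W : WeierstrassCurve ℚ} [W.IsElliptic] (D : ModularParametrizationData W N) : Prop :=
  W.kodairaSymbolAt placeThree = .IIstar ∨ W.kodairaSymbolAt placeThree = .IIIstar ∨
    (W.kodairaSymbolAt placeThree = .IVstar ∧ (¬ RamanujanCut.HasRationalThreeTorsion W ∨ HasEisensteinIVStarCompanionAtThree D))

/-- **E-imc-153e `OmegaDefectOfClassV3AtThree`** (LAW L3g, defect direction; nothing asserted; BC5: 117/117 class-V3 rows
`≤ 1251`, of which 35 out of the fitting sample `≤ 1026`).  Why it might fail: a torsion-free IV* curve whose newform is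
mod-3 multiplicity-one in every sense (no congruent newform at all, rational or not) might have full depth — none seen. -/
@[conjecture] def OmegaDefectOfClassV3AtThree : Prop :=
  ∀ (W : WeierstrassCurve ℚ) [W.IsElliptic] [W.IsGloballyMinimal] [NeZero (W.conductorNorm ℤ)]
    (D : ModularParametrizationData W (W.conductorNorm ℤ)),
    (∀ z ∈ D.L.lattice, ∃ w ∈ periodLattice D.f, z = D.c * w) →
    (∀ (W' : WeierstrassCurve ℚ) [W'.IsElliptic]
        (D' : ModularParametrizationData W' (W.conductorNorm ℤ)),
        D'.f = D.f → D.modularDegree ≤ D'.modularDegree) →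
    9 ∣ W.conductorNorm ℤ → ¬ 81 ∣ W.conductorNorm ℤ → IsOmegaDefectClassAtThreeV3 D →
      padicValNat 3 (lineIndex (omegaLatticeAtThree (W.conductorNorm ℤ)) D.f) + 1 = padicValNat 3 D.modularDegree

/-- **E-imc-153f `OmegaFullDepthOffClassV3AtThree`** (LAW L3g, full-depth direction; nothing asserted; BC5: 508/508 rows
`≤ 1251` off class V3).  With E-imc-150/151: the E-blind certificate `3 ∤ c_E ∧ LieSaturatedAt 3` for these curves.
Why it might fail: an I_n* curve at a level with deep purely-new congruences (none among 332 I_n* rows). -/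
@[conjecture] def OmegaFullDepthOffClassV3AtThree : Prop :=
  ∀ (W : WeierstrassCurve ℚ) [W.IsElliptic] [W.IsGloballyMinimal] [NeZero (W.conductorNorm ℤ)]
    (D : ModularParametrizationData W (W.conductorNorm ℤ)),
    (∀ z ∈ D.L.lattice, ∃ w ∈ periodLattice D.f, z = D.c * w) →
    (∀ (W' : WeierstrassCurve ℚ) [W'.IsElliptic]
        (D' : ModularParametrizationData W' (W.conductorNorm ℤ)),
        D'.f = D.f → D.modularDegree ≤ D'.modularDegree) →
    9 ∣ W.conductorNorm ℤ → ¬ 81 ∣ W.conductorNorm ℤ → ¬ IsOmegaDefectClassAtThreeV3 D →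
      padicValNat 3 (lineIndex (omegaLatticeAtThree (W.conductorNorm ℤ)) D.f) = padicValNat 3 D.modularDegree

/-- Edge (PROVED, re-pointed by the typer from the killed E-imc-153b to the class-V3 laws of L3g): the two repaired Kodaira laws
E-imc-153e/f imply the defect bound E-imc-152. -/
theorem omegaDefectAtThreeLeOne_of_lawsV3 (ha : OmegaDefectOfClassV3AtThree) (hb : OmegaFullDepthOffClassV3AtThree) :
    OmegaDefectAtThreeLeOne := by
  intro W _ _ _ D hL hopt h9 h81
  by_cases hc : IsOmegaDefectClassAtThreeV3 D
  · have := ha W D hL hopt h9 h81 hc; omega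
  · have := hb W D hL hopt h9 h81 hc; omega

/-- The E-blind Manin-at-3 certificate OFF the repaired class (PROVED chain; conditional on the GIVEN row E-imc-150, the
transfer E-imc-151, the law E-imc-153f and finiteness of the index): `3 ∤ c_E` for every optimal `E` with `9 ∣ N`, `81 ∤ N`
outside the class-V3 Ω-defect class (LAW L3g) — no input from Cremona's table (re-pointed by the typer from the killed E-imc-153b). -/
theorem not_three_dvd_maninConstant_of_fullDepthOffClassV3 (hT : OmegaDepthTransferAtThree)
    (hb : OmegaFullDepthOffClassV3AtThree)
    (W : WeierstrassCurve ℚ) [W.IsElliptic] [W.IsGloballyMinimal] [NeZero (W.conductorNorm ℤ)]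
    (D : ModularParametrizationData W (W.conductorNorm ℤ)) (Δ : NeronFLineDatum W D)
    (hL : ∀ z ∈ D.L.lattice, ∃ w ∈ periodLattice D.f, z = D.c * w)
    (hopt : ∀ (W' : WeierstrassCurve ℚ) [W'.IsElliptic]
        (D' : ModularParametrizationData W' (W.conductorNorm ℤ)),
        D'.f = D.f → D.modularDegree ≤ D'.modularDegree)
    (h9 : 9 ∣ W.conductorNorm ℤ) (h81 : ¬ 81 ∣ W.conductorNorm ℤ) (hc : ¬ IsOmegaDefectClassAtThreeV3 D)
    (hΛ : IsOmegaNeronAtThree Δ) (hfin : lineIndex (omegaLatticeAtThree (W.conductorNorm ℤ)) D.f ≠ 0) :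
    ¬ (3 : ℤ) ∣ D.maninConstant :=
  not_three_dvd_maninConstant_of_omegaDepth hT Δ h9 hΛ (hb W D hL hopt h9 h81 hc) hfin

end CongruentPartner

/-! ### §7. The TANGENT-DEFECT lever (crux idea `tangent-defect-class-3` on C3): shallow-by-one + not Lie-saturated ⇒ `3 ∤ c_E`

Bookkeeping on the `f`-line: `ord₃ c_E = σ^Λ − k₃` (`σ^Λ` = Néron depth defect, `k₃` = Lie-saturation defect).  ENGINE 7/8 +
the GIVEN row make `σ^Λ = σ^Ω ∈ {0, 1}` E-blindly computable; law L3f says WHICH curves have `σ = 1`.  So Manin at 3 on those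
curves is EXACTLY the E-facing statement «the optimal `𝒥₀(N) → 𝓔` is not surjective on tangent spaces at 3» — a statement
about Néron models of a II*/III*/IV*-curve and its optimal quotient map, with NO `c_E` and NO modular-degree table in it. -/

section TangentDefect

variable {N} {W : WeierstrassCurve ℚ} [W.IsElliptic] {D : ModularParametrizationData W N} (Δ : NeronFLineDatum W D)

/-- A SHALLOW-BY-AT-MOST-ONE witness on the `f`-line of `Λ`: some Néron differential has `f`-coordinate `q` with
`ord₃ q ≤ −ord₃(deg φ) + 1` (E-blindly: `σ^Ω ≤ 1`, law E-imc-152, transported into `Λ` by the GIVEN row E-imc-150). -/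
def HasShallowByOneWitnessAt (p : ℕ) : Prop :=
  ∃ g : Δ.Λ, ∃ q : ℚ, q ≠ 0 ∧
    (q : ℂ) * peterssonProduct (Gamma0 N) 2 D.f D.f = peterssonProduct (Gamma0 N) 2 D.f g ∧
    padicValRat p q ≤ -(padicValNat p D.modularDegree : ℤ) + 1

/-- **PROVED (the lever's glue)**: a shallow-by-one witness + total tangent defect at `p` (`¬ LieSaturatedAt p`: every
Néron differential pulls back to `p · ℤ ω`) ⇒ `p ∤ c_E`.  Proof: `ξ^*(g) = (deg φ / c) q ∈ p ℤ ∖ {0}` has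
`ord_p = ord_p deg φ − ord_p c + ord_p q ≤ 1 − ord_p c`, and it is `≥ 1`. -/
theorem not_dvd_maninConstant_of_shallowByOne_of_not_lieSaturated {p : ℕ} [hp : Fact p.Prime]
    (hw : HasShallowByOneWitnessAt Δ p) (hk : ¬ Δ.LieSaturatedAt p) : ¬ (p : ℤ) ∣ D.maninConstant := by
  obtain ⟨g, q, hq0, hq, hval⟩ := hw
  have hdeg : (D.modularDegree : ℚ) ≠ 0 := by exact_mod_cast D.deg_pos.ne'
  have hκc := Δ.κ_mul_maninConstant
  have hc : (D.maninConstant : ℚ) ≠ 0 := by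
    intro h0; rw [h0, mul_zero] at hκc; exact hdeg hκc.symm
  have hκ : Δ.κ = D.modularDegree / D.maninConstant := by rw [eq_div_iff hc]; exact hκc
  have hx : (Δ.xiStar g : ℚ) = D.modularDegree / D.maninConstant * q := by
    rw [← hκ]; exact Δ.xiStar_eq_of_coord hq
  have hxne : (Δ.xiStar g : ℚ) ≠ 0 := by
    rw [hx]; exact mul_ne_zero (div_ne_zero hdeg hc) hq0
  have hxz : Δ.xiStar g ≠ 0 := by exact_mod_cast hxne
  have hcz : D.maninConstant ≠ 0 := by exact_mod_cast hc
  -- total tangent defect: `p ∣ ξ^*(g)`, hence `ord_p ξ^*(g) ≥ 1`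
  have hpdvd : (p : ℤ) ∣ Δ.xiStar g := by
    by_contra hnd; exact hk ⟨g, hnd⟩
  have hxval : 1 ≤ padicValInt p (Δ.xiStar g) := by
    rcases (padicValInt_dvd_iff 1 (Δ.xiStar g)).mp (by simpa using hpdvd) with h | h
    · exact absurd h hxz
    · exact h
  have h1 : padicValRat p (Δ.xiStar g : ℚ) = padicValRat p (D.modularDegree : ℚ)
      - padicValRat p (D.maninConstant : ℚ) + padicValRat p q := by
    rw [hx, padicValRat.mul (div_ne_zero hdeg hc) hq0, padicValRat.div hdeg hc]
  rw [padicValRat.of_int, padicValRat.of_int, padicValRat.of_nat] at h1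
  have hxval' : (1 : ℤ) ≤ (padicValInt p (Δ.xiStar g) : ℤ) := by exact_mod_cast hxval
  have hcval : (padicValInt p D.maninConstant : ℤ) ≤ 0 := by linarith
  intro hdvd
  rcases (padicValInt_dvd_iff 1 D.maninConstant).mp (by simpa using hdvd) with h0 | h1'
  · exact hcz h0
  · omega

/-- **E-imc-157R `TangentDefectOnClassV3AtThreeR`** (the E-FACING CRUX of the idea, REPAIRED per REF1 §R90; nothing asserted): for an
optimal curve in the Ω-defect class at 3, form V3 (II*, III*, torsion-free IV*, or IV* with an Eisenstein IV*-companion; `9 ∣ N`, `81 ∤ N`)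
whose Néron `f`-line datum `Δ` satisfies the GIVEN row `IsOmegaNeronAtThree Δ`, the optimal map is NOT Lie-saturated at 3 — every Néron
differential of `J₀(N)` pulls back to `3ℤ · ω`.  The sketch's form `TangentDefectOnClassV3AtThree` (no Ω/Néron binder on `Δ`) is NOT landed:
REF1 §R90 KILLED E-imc-157 as typed (the junk datum `Λ_max = {g ∈ S^AL : (deg/c)·q(g) ∈ ℤ}` is a `NeronFLineDatum` and is Lie-saturated
at 3 on every class row — ref1 e90, 292/292 classes `≤ 711`, `c`-free; the argument is class-independent, so it applies verbatim to the V3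
re-targeting), REPAIR = insert `IsOmegaNeronAtThree Δ →`; with the binder, on the class the law ⟺ `3 ∤ c_E` (a reformulation — ref1).
BC5 (imc): forced on 117/117 class-V3 rows `≤ 1251` by ENGINE 7/8 + the print inclusion `Λ ⊆ Ω₃` + Cremona's `c_E = 1` (PROVED edge
`three_dvd_or_not_lieSaturated_of_omegaUpper`); as a THEOREM it would be new (print knows `k_p = 0` only at `p ∥ N`: Mazur 1978
Cor. 1.1, Abbes–Ullmo 1996, ARS Thm. 3.10 via Raynaud's `e < p − 1`).  Why it might fail: it cannot fail on a row where `c_E = 1` is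
known and `σ^Ω = 1` is computed; it fails as a LAW only if the class clause mis-predicts `σ` (pre-registered OOS test) — or if some `c_E = 3`.
TYPER FRAMING (E-imc-157R): lens imc; LAW (obligation node), nothing asserted. [conjecture — cell candidate, NOT a tree fact] -/
@[conjecture] def TangentDefectOnClassV3AtThreeR : Prop :=
  ∀ (W : WeierstrassCurve ℚ) [W.IsElliptic] [W.IsGloballyMinimal] [NeZero (W.conductorNorm ℤ)]
    (D : ModularParametrizationData W (W.conductorNorm ℤ)) (Δ : NeronFLineDatum W D),
    (∀ z ∈ D.L.lattice, ∃ w ∈ periodLattice D.f, z = D.c * w) →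
    (∀ (W' : WeierstrassCurve ℚ) [W'.IsElliptic]
        (D' : ModularParametrizationData W' (W.conductorNorm ℤ)),
        D'.f = D.f → D.modularDegree ≤ D'.modularDegree) →
    9 ∣ W.conductorNorm ℤ → ¬ 81 ∣ W.conductorNorm ℤ → IsOmegaNeronAtThree Δ → IsOmegaDefectClassAtThreeV3 D →
      ¬ Δ.LieSaturatedAt 3

/-- **E-imc-158 `ShallowByOneTransferAtThree`** (support, bookkeeping like E-imc-151; nothing asserted): the GIVEN row
`Λ ⊗ ℤ₍₃₎ = Ω₃ ⊗ ℤ₍₃₎` + the E-blind bound `σ^Ω ≤ 1` (E-imc-152, as the `lineIndex` inequality) ⇒ a shallow-by-one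
witness inside `Λ`. -/
@[conjecture] def ShallowByOneTransferAtThree : Prop :=
  ∀ (N : ℕ) [NeZero N] (W : WeierstrassCurve ℚ) [W.IsElliptic] (D : ModularParametrizationData W N)
    (Δ : NeronFLineDatum W D), 9 ∣ N → IsOmegaNeronAtThree Δ →
    padicValNat 3 D.modularDegree ≤ padicValNat 3 (lineIndex (omegaLatticeAtThree N) D.f) + 1 →
    lineIndex (omegaLatticeAtThree N) D.f ≠ 0 → HasShallowByOneWitnessAt Δ 3

/-- **ASSEMBLY of the idea (PROVED modulo the named hypotheses)**: GIVEN row (E-imc-150) + E-blind defect bound (E-imc-152)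
+ transfers (E-imc-151/158) + the full-depth law (E-imc-153f, form V3) + the repaired tangent-defect crux (E-imc-157R) ⇒ `3 ∤ c_E`
for every optimal curve with `9 ∣ N`, `81 ∤ N` whose GIVEN row holds (rat-sing levels: ČNS + dictionary). -/
theorem not_three_dvd_maninConstant_of_tangentDefect
    (hT : OmegaDepthTransferAtThree) (hS : ShallowByOneTransferAtThree)
    (h152 : OmegaDefectAtThreeLeOne) (h153f : OmegaFullDepthOffClassV3AtThree) (h157 : TangentDefectOnClassV3AtThreeR)
    {W : WeierstrassCurve ℚ} [W.IsElliptic] [W.IsGloballyMinimal] [NeZero (W.conductorNorm ℤ)]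
    (D : ModularParametrizationData W (W.conductorNorm ℤ)) (Δ : NeronFLineDatum W D)
    (hopt₁ : ∀ z ∈ D.L.lattice, ∃ w ∈ periodLattice D.f, z = D.c * w)
    (hopt₂ : ∀ (W' : WeierstrassCurve ℚ) [W'.IsElliptic] (D' : ModularParametrizationData W' (W.conductorNorm ℤ)),
        D'.f = D.f → D.modularDegree ≤ D'.modularDegree)
    (h9 : 9 ∣ W.conductorNorm ℤ) (h81 : ¬ 81 ∣ W.conductorNorm ℤ) (hΛ : IsOmegaNeronAtThree Δ)
    (hfin : lineIndex (omegaLatticeAtThree (W.conductorNorm ℤ)) D.f ≠ 0) :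
    ¬ (3 : ℤ) ∣ D.maninConstant := by
  haveI : Fact (Nat.Prime 3) := ⟨Nat.prime_three⟩
  by_cases hcl : IsOmegaDefectClassAtThreeV3 D
  · exact not_dvd_maninConstant_of_shallowByOne_of_not_lieSaturated Δ
      (hS _ W D Δ h9 hΛ (h152 W D hopt₁ hopt₂ h9 h81) hfin) (h157 W D Δ hopt₁ hopt₂ h9 h81 hΛ hcl)
  · exact not_three_dvd_maninConstant_of_omegaDepth hT Δ h9 hΛ (h153f W D hopt₁ hopt₂ h9 h81 hcl) hfin

end TangentDefect

end Summit.BirchSwinnertonDyer.Rank1Residual.ManinAdditive.NeronOmegaThree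

end
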